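/-
Copyright (c) 2026. All rights reserved.
Released under Apache 2.0 license as described in the file LICENSE.
-/
import Literature.NumberTheory.Automorphic.QuaternionicSIdealClassesAdmissible
import HarnessLib

/-!
# The Atkin–Lehner signs of a quaternionic eigen-line: a multiplicity-one Hecke eigenvector of the Brandt module is an
# eigenvector of every local involution `W_r`, has a sign pattern, and vanishes on the `W_q`-fixed classes of sign `−1`
# (Martin 2018, §3.1, §3.3, §4.2)

[tag: quaternion_algebra] [tag: eichler_order] [tag: hecke_operator]

Topic `NumberTheory/Automorphic`. Lane `lit-hodgefound`, seat p12, gen 52 — sequel of `BrandtAtkinLehnerSign.lean` (`T(q)`,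
`q ∣ N⁻`, acts on a multiplicity-one eigen-lattice by a sign `ε`; existence only) and the bridge between the tree's eigen-lattices
`eigenLattice N T λ = {v ∈ ℤ^{Cls O} : T(p) v = λ(p) v for all primes p ∤ N}` (`BrandtXi.lean`; a multiplicity-one
eigen-line is `eigenLattice … = ℤ ∙ φ`, as in `BrandtEigenAugmentation.lean`) and the sign spaces `M^χ(O)` of
`BrandtModuleSignPatternDecomposition.lean`.

[Martin2018, §3.1]: "we say `φ ∈ M_k(O)` is an eigenform if it is an eigenfunction of all `T_𝔭`'s … The
diagonalizability of the ramified Hecke operators `T_𝔭`, `𝔭 ∣ 𝔑`, follows from the fact that they are involutions. …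
Since `T_𝔭 φ = π(ϖ_{B_𝔭}) φ`, we see that `T_𝔭` acts on `φ` by `+1` (resp. `−1`) …"; [Martin2018, §3.3]: the sign pattern
of an eigenform, `M_k^χ(O) = ⟨φ eigenform : T_𝔭 φ = χ_𝔭 φ for all 𝔭 ∣ 𝔐⟩`; [Martin2018, §4.2 (after Lemma 5)]:
"`φ(x_i) = 0` if `σ_𝔭(x_i) = x_i` and `χ_𝔭 = −1`".

For a Brandt setup `S` (an Eichler order `O` of level `N⁺`, discriminant `N⁻`, over `ℚ`) and `φ : Cls O → ℤ`:

* §1 DEFINITION `XiSetup.atkinLehnerSign φ r ∈ {±1}` (`= 1` iff `φ ∘ W_r = φ`); `mulVec_comp_atkinLehner`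
  (`T(n)(v ∘ W_r) = (T(n) v) ∘ W_r` over `ℤ`), **`comp_atkinLehner_mem_eigenLattice`** (`W_r` preserves every eigen-lattice);
* §2 for an EIGEN-LINE `eigenLattice N (matrix O) λ = ℤ ∙ φ` (any `N`, e.g. `N⁺N⁻`): ★ **`comp_atkinLehner_eq_atkinLehnerSign_smul`**
  (`φ ∘ W_r = ε_r(φ) φ`: the eigenvector is an eigenvector of every `W_r`), `atkinLehnerSign_unique`,
  `atkinLehnerSign_eq_one_of_not_dvd_mul` (`r ∤ N⁺N⁻`), ★ **`intCast_mem_signSpace_atkinLehnerSign`** (`φ ∈ M^{ε(φ)|_T}(O)`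
  for every `T`: the eigenform has the sign pattern `ε(φ)`), **`matrix_ramified_mulVec_eq_atkinLehnerSign_smul`**
  (`T(q) φ = ε_q(φ) φ` at a ramified `q`: the ramified Hecke eigenvalue IS the Atkin–Lehner sign);
* §3 VANISHING: ★ **`apply_eq_zero_of_atkinLehner_eq_self`** (`W_r c = c`, `ε_r(φ) = −1` ⇒ `φ(c) = 0`),
  **`apply_eq_zero_of_exists_reducedNorm_eq`** (`q ∣ N⁻`, `ε_q(φ) = −1`, and `O_L(I_c)` contains an element of reduced
  norm `q` ⇒ `φ(c) = 0`), `isAdmissible_of_apply_ne_zero` (the `T`-class of any `c` with `φ(c) ≠ 0` is `ε(φ)`-admissible),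
  and **`atkinLehnerSign_eq_one_of_natCard_typeSet_eq`** (type number = class number ⇒ every eigen-line has all signs `+1`).

## References

* [Martin2018] K. Martin, *Congruences for modular forms mod 2 and quaternionic `S`-ideal classes*, Canad. J. Math. 70
  (2018) (held: arXiv 1701.07864): §3.1, §3.3, §4.2.
* [PollackWeston2011] R. Pollack, T. Weston, *On anticyclotomic μ-invariants of modular forms*, Compos. Math. 147
  (2011), §2.1 (the eigen-line `M^f` and its Atkin–Lehner signs; as in `BrandtAtkinLehnerSign.lean`).
* [VignerasLNM800] M.-F. Vignéras, *Arithmétique des algèbres de quaternions*, LNM 800 (1980), Ch. III §5 exercice 5.8.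
* [Voight2021] J. Voight, *Quaternion Algebras*, GTM 288 (2021): (41.3.5), Cor. 41.4.10.

## Scope (honest)

The equality of `ε_q(φ)` with the Atkin–Lehner eigenvalue of the classical newform attached to `φ` by Jacquet–Langlands
(`T_𝔭 = −W_𝔭` in Martin's normalisation) is NOT asserted: only the quaternionic side is treated. One definition, theorems
otherwise; no named fact, no instance.
-/

noncomputable section

open scoped Pointwise Matrix

namespace Literature.NumberTheory.Automorphic

namespace Brandt

variable {Nplus Nminus : ℕ} (S : XiSetup Nplus Nminus)

/-! ## §1 The sign of a function under `W_r`; `W_r` preserves eigen-lattices -/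

open Classical in
/-- **The Atkin–Lehner sign `ε_r(φ) ∈ {±1}` of `φ : Cls O → ℤ` at `r`**: `+1` if `φ ∘ W_r = φ`, `−1` otherwise (for a
multiplicity-one eigenvector, `φ ∘ W_r = ε_r(φ) φ`, §2; at a ramified `q ∣ N⁻` this is the sign `ε` of
`XiSetup.exists_atkinLehnerSign`, `BrandtAtkinLehnerSign.lean`, now defined for every `r`, the level involutions `W_{p⁺}`
included). [cite: Martin2018, §3.1 ("`T_𝔭` acts on `φ` by `+1` (resp. `−1`)") and §3.3] [cite: PollackWeston2011, §2.1] -/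
def XiSetup.atkinLehnerSign (φ : ClassSet S.O → ℤ) (r : ℕ) : ℤˣ :=
  if φ ∘ S.atkinLehner r = φ then 1 else -1

/-- `ε_r(φ) = 1` iff `φ ∘ W_r = φ`. [cite: Martin2018, §3.1] -/
theorem XiSetup.atkinLehnerSign_eq_one_iff (φ : ClassSet S.O → ℤ) (r : ℕ) :
    S.atkinLehnerSign φ r = 1 ↔ φ ∘ S.atkinLehner r = φ := by
  classical
  unfold XiSetup.atkinLehnerSign
  split_ifs with h
  · exact ⟨fun _ => h, fun _ => rfl⟩
  · exact ⟨fun h1 => absurd h1 (by decide), fun h' => absurd h' h⟩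

/-- **`T(n)(v ∘ W_r) = (T(n) v) ∘ W_r` on `ℤ^{Cls O}`** for every `n` and `r`. [cite: Voight2021, (41.3.5)] [cite: VignerasLNM800, Ch. III §5 exercice 5.8 (d)] -/
theorem XiSetup.mulVec_comp_atkinLehner [Fintype (ClassSet S.O)] (r n : ℕ) (v : ClassSet S.O → ℤ) :
    matrix S.O n *ᵥ (v ∘ S.atkinLehner r) = (matrix S.O n *ᵥ v) ∘ S.atkinLehner r := by
  by_cases hr : r.Prime
  · haveI : Fact r.Prime := ⟨hr⟩
    by_cases h : r ∣ Nminus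
    · rw [S.atkinLehner_of_dvd h]; exact S.mulVec_comp_wMinus h n v
    · rw [S.atkinLehner_of_not_dvd h]; exact S.mulVec_comp_wPlus h n v
  · rw [S.atkinLehner_of_not_prime hr, Function.comp_id, Function.comp_id]

/-- **`W_r` preserves every eigen-lattice `L(λ) = {v : T(p) v = λ(p) v, p ∤ N prime}`** (it commutes with the `T(p)`).
[cite: Martin2018, §3.1 ("a commuting family")] [cite: Voight2021, Cor. 41.4.10] -/
theorem XiSetup.comp_atkinLehner_mem_eigenLattice [Fintype (ClassSet S.O)] {N : ℕ} {lam : ℕ → ℤ}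
    {v : ClassSet S.O → ℤ} (hv : v ∈ eigenLattice N (matrix S.O) lam) (r : ℕ) :
    v ∘ S.atkinLehner r ∈ eigenLattice N (matrix S.O) lam := by
  intro p hp hpN
  rw [S.mulVec_comp_atkinLehner r p v, hv p hp hpN]
  rfl

/-! ## §2 Eigen-lines: `φ ∘ W_r = ε_r(φ) φ` -/

section Line

variable [Fintype (ClassSet S.O)] {N : ℕ} {lam : ℕ → ℤ} {φ : ClassSet S.O → ℤ}
  (hL : eigenLattice N (matrix S.O) lam = ℤ ∙ φ)
include hL

/-- On an eigen-line, `φ ∘ W_r = c φ` for some integer `c`. [cite: Martin2018, §3.1] -/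
theorem XiSetup.exists_comp_atkinLehner_eq_zsmul (r : ℕ) : ∃ c : ℤ, φ ∘ S.atkinLehner r = c • φ := by
  have hφ : φ ∈ eigenLattice N (matrix S.O) lam := by rw [hL]; exact Submodule.mem_span_singleton_self φ
  have h := S.comp_atkinLehner_mem_eigenLattice hφ r
  rw [hL] at h
  obtain ⟨c, hc⟩ := Submodule.mem_span_singleton.mp h
  exact ⟨c, hc.symm⟩

/-- **`φ ∘ W_r = ε_r(φ) φ`: a multiplicity-one Hecke eigenvector is an eigenvector of every local Atkin–Lehner
involution, with eigenvalue `±1`** (for `W_{q⁻} = T(q)`, `q ∣ N⁻`, cf. `XiSetup.exists_atkinLehnerSign`).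
[cite: Martin2018, §3.1 and §3.3] [cite: PollackWeston2011, §2.1] -/
theorem XiSetup.comp_atkinLehner_eq_atkinLehnerSign_smul (r : ℕ) :
    φ ∘ S.atkinLehner r = (S.atkinLehnerSign φ r : ℤ) • φ := by
  classical
  obtain ⟨c, hc⟩ := S.exists_comp_atkinLehner_eq_zsmul hL r
  unfold XiSetup.atkinLehnerSign
  split_ifs with h
  · rw [h, Units.val_one, one_smul]
  · -- `c ≠ 1`, and `c² = 1` unless `φ = 0`
    rw [hc, Units.val_neg, Units.val_one, neg_smul, one_smul]
    by_cases hφ : φ = 0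
    · rw [hφ, smul_zero, neg_zero]
    · have h2 : (c * c) • φ = φ := by
        have this : (φ ∘ S.atkinLehner r) ∘ S.atkinLehner r = (c • φ) ∘ S.atkinLehner r :=
          congrArg (fun ψ : ClassSet S.O → ℤ => ψ ∘ S.atkinLehner r) hc
        rw [Function.comp_assoc, (S.involutive_atkinLehner r).comp_self, Function.comp_id] at this
        -- `φ = (c • φ) ∘ W_r = c • (φ ∘ W_r) = c • c • φ`
        have e : (c • φ) ∘ S.atkinLehner r = c • (φ ∘ S.atkinLehner r) := rfl
        rw [e, hc, smul_smul] at this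
        exact this.symm
      have hcc : c * c = 1 := by
        have h1 : (c * c - 1) • φ = 0 := by rw [sub_smul, h2, one_smul, sub_self]
        rcases smul_eq_zero.mp h1 with h0 | h0
        · linarith
        · exact absurd h0 hφ
      have hc1 : c ≠ 1 := by
        intro h1; rw [h1, one_smul] at hc; exact h hc
      rcases Int.mul_eq_one_iff_eq_one_or_neg_one.mp hcc with ⟨h1, -⟩ | ⟨h1, -⟩
      · exact absurd h1 hc1
      · rw [h1, neg_smul, one_smul]

/-- Pointwise: `φ(W_r c) = ε_r(φ) φ(c)`. [cite: Martin2018, §3.1 and §4.2 (4.3)] -/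
theorem XiSetup.apply_atkinLehner_eq_atkinLehnerSign_mul (r : ℕ) (c : ClassSet S.O) :
    φ (S.atkinLehner r c) = (S.atkinLehnerSign φ r : ℤ) * φ c := by
  have h := congrFun (S.comp_atkinLehner_eq_atkinLehnerSign_smul hL r) c
  rwa [Function.comp_apply, Pi.smul_apply, smul_eq_mul] at h

/-- The sign is the unique `u ∈ {±1}` with `φ ∘ W_r = u φ` (`φ ≠ 0`). [cite: Martin2018, §3.1] -/
theorem XiSetup.atkinLehnerSign_unique (hφ : φ ≠ 0) {r : ℕ} {u : ℤˣ} (hu : φ ∘ S.atkinLehner r = (u : ℤ) • φ) :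
    u = S.atkinLehnerSign φ r := by
  have h := S.comp_atkinLehner_eq_atkinLehnerSign_smul hL r
  rw [hu] at h
  exact Units.ext (smul_left_injective ℤ hφ h)

/-- At `r ∤ N⁺N⁻` the sign is `+1` (`W_r = 1`). [cite: Voight2021, (23.4.20)] -/
theorem XiSetup.atkinLehnerSign_eq_one_of_not_dvd_mul {r : ℕ} (hr : ¬ r ∣ Nplus * Nminus) :
    S.atkinLehnerSign φ r = 1 := by
  have _ := hL
  rw [S.atkinLehnerSign_eq_one_iff]
  funext c
  rw [Function.comp_apply, S.atkinLehner_eq_self_of_not_dvd_mul hr]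

/-- **The eigenvector has the sign pattern `ε(φ)`: `φ ∈ M^{ε(φ)|_T}(O)` for every finite `T`** (as a rational function).
[cite: Martin2018, §3.3 (`M_k^χ(O)` is spanned by the eigenforms of sign pattern `χ`)] -/
theorem XiSetup.intCast_mem_signSpace_atkinLehnerSign (T : Finset ℕ) :
    (fun c => (φ c : ℚ)) ∈ S.signSpace T fun r => S.atkinLehnerSign φ r := by
  rw [S.mem_signSpace_iff]
  intro r c
  rw [S.apply_atkinLehner_eq_atkinLehnerSign_mul hL r c, Int.cast_mul]

/-- **`T(q) φ = ε_q(φ) φ` at a ramified prime `q ∣ N⁻`**: the ramified Hecke eigenvalue of the eigen-line is its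
Atkin–Lehner sign (`T(q)` is the permutation matrix of `W_{q⁻}`). [cite: Martin2018, §3.1 ("`T_𝔭` acts on `φ` by `+1` (resp. `−1`)")] [cite: VignerasLNM800, Ch. III §5 exercice 5.8 (b)] -/
theorem XiSetup.matrix_ramified_mulVec_eq_atkinLehnerSign_smul {q : ℕ} [Fact q.Prime] (hq : q ∣ Nminus) :
    matrix S.O q *ᵥ φ = (S.atkinLehnerSign φ q : ℤ) • φ := by
  funext c
  rw [S.matrix_ramified_mulVec_of_dvd hq φ c, ← S.atkinLehner_of_dvd hq, Pi.smul_apply, smul_eq_mul]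
  exact S.apply_atkinLehner_eq_atkinLehnerSign_mul hL q c

/-! ## §3 Vanishing at fixed classes of sign `−1` -/

/-- **`φ(c) = 0` at every class `c` fixed by `W_r` when `ε_r(φ) = −1`** ("`φ(x_i) = 0` if `σ_𝔭(x_i) = x_i` and
`χ_𝔭 = −1`"). [cite: Martin2018, §4.2 (after Lemma 5)] -/
theorem XiSetup.apply_eq_zero_of_atkinLehner_eq_self {r : ℕ} {c : ClassSet S.O} (hc : S.atkinLehner r c = c)
    (hε : S.atkinLehnerSign φ r = -1) : φ c = 0 := by
  have h := S.apply_atkinLehner_eq_atkinLehnerSign_mul hL r c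
  rw [hc, hε, Units.val_neg, Units.val_one, neg_one_mul] at h
  linarith

/-- **Arithmetic vanishing: if `q ∣ N⁻`, `ε_q(φ) = −1` and the left order `O_L(I_c)` contains an element of reduced norm
`q`, then `φ(c) = 0`** (`W_{q⁻} c = c` iff `O_L(I_c) ∋ x` with `nrd x = q`, `BrandtMatrixRamifiedDivisors`).
[cite: Martin2018, §4.2 (after Lemma 5)] [cite: Voight2021, (30.9.3)] -/
theorem XiSetup.apply_eq_zero_of_exists_reducedNorm_eq {q : ℕ} [Fact q.Prime] (hq : q ∣ Nminus) {c : ClassSet S.O}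
    (hx : ∃ x ∈ leftOrder c.rep, reducedNorm ℚ S.D x = q) (hε : S.atkinLehnerSign φ q = -1) : φ c = 0 := by
  refine S.apply_eq_zero_of_atkinLehner_eq_self hL ?_ hε
  rw [S.atkinLehner_of_dvd hq]
  exact (S.wMinus_eq_self_iff hq c).mpr hx

/-- The `T`-class of a class where `φ` does not vanish is `ε(φ)`-admissible. [cite: Martin2018, §4.4 Prop. 7 (proof)] -/
theorem XiSetup.isAdmissible_of_apply_ne_zero (T : Finset ℕ) {c : ClassSet S.O} (hc : φ c ≠ 0) :
    S.IsAdmissible T (fun r => S.atkinLehnerSign φ r) (S.sClassOf T c) :=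
  S.isAdmissible_of_mem_signSpace_of_ne_zero (S.intCast_mem_signSpace_atkinLehnerSign hL T)
    (by exact_mod_cast hc)

/-- A nonzero eigenvector forces `dim M^{ε(φ)|_T}(O) ≥ 1`: some `T`-class is `ε(φ)`-admissible. [cite: Martin2018, §4.4 Prop. 7] -/
theorem XiSetup.exists_isAdmissible_of_ne_zero (hφ : φ ≠ 0) (T : Finset ℕ) :
    ∃ X : S.SClassSet T, S.IsAdmissible T (fun r => S.atkinLehnerSign φ r) X := by
  obtain ⟨c, hc⟩ : ∃ c, φ c ≠ 0 := by
    by_contra h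
    push Not at h
    exact hφ (funext h)
  exact ⟨S.sClassOf T c, S.isAdmissible_of_apply_ne_zero hL T hc⟩

/-- **If the type number equals the class number, every eigen-line has all Atkin–Lehner signs `+1`** (all the
involutions are then trivial on `Cls O`, `EichlerOrdersAtkinLehnerGroup`). [cite: Voight2021, Cor. 18.5.12 and (23.4.20)] [cite: Martin2018, §2 (`t_B = h_B` iff …)] -/
theorem XiSetup.atkinLehnerSign_eq_one_of_natCard_typeSet_eq (h : Nat.card (TypeSet S.O) = Nat.card (ClassSet S.O))
    (r : ℕ) : S.atkinLehnerSign φ r = 1 := by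
  have _ := hL
  obtain ⟨hM, hP⟩ := (S.natCard_typeSet_eq_natCard_classSet_iff_forall_atkinLehner).mp h
  rw [S.atkinLehnerSign_eq_one_iff]
  funext c
  rw [Function.comp_apply]
  by_cases hr : r.Prime
  · haveI : Fact r.Prime := ⟨hr⟩
    by_cases hd : r ∣ Nminus
    · rw [S.atkinLehner_of_dvd hd, hM r inferInstance hd c]
    · rw [S.atkinLehner_of_not_dvd hd, hP r inferInstance hd c]
  · rw [S.atkinLehner_of_not_prime hr, id_eq]

end Line

end Brandt

end Literature.NumberTheory.Automorphic
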